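import Literature.NumberTheory.EllipticCurves.DivisionField
import HarnessLib

/-!
# An automorphism fixing `E[M]` pointwise has a `p`-power fixing `E[M·pⁿ]` pointwise (`p ∣ M`):
# `Gal(K(E[M pⁿ])/K(E[M]))` is a `p`-group, element by element

Topic `NumberTheory/EllipticCurves` (namespace `WeierstrassCurve`, as `DivisionField.lean`). Cell `bsd-print-cf2`
(`run/shared/lean/pub/bsd-print-cf2/`), width seat `bsd-line-cf2c-w2` g8 — the «pow-fix» clauses of ty2's `TowerGaloisHyps` for the
`p`-division tower `K(E[q pⁿ])` (the tower of the typed print `LiTianYanZhu2025.thm72_…`), consumed by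
`Summits/…/Theorems/PrintCf2RubinValueTwoCClassDivisionTowerPackages.lean`. THEOREMS ONLY (no `def`, no named fact, no `sorry`).
HONEST FRAMING: elementary group-action bookkeeping; BSD is not advanced by this file.

THE ARGUMENT (Silverman AEC III.§7 / Serre 1972 §4: `ker(Aut E[Mp] → Aut E[M])` is killed by `p`, written without matrices). Let
`σ ∈ Γ_K` fix `E[M]` pointwise, `p ∣ M`, `T ∈ E[M·p]`. Put `e := σT − T`. Then `pT ∈ E[M]` is fixed, so `p·e = σ(pT) − pT = 0`; and
`M·e = (M/p)·(p·e) = 0`, so `e ∈ E[M]` is fixed by `σ`. Hence `σᵏT = T + k·e` for all `k` (`smul_pow_eq_add_nsmul`), and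
`σᵖT = T + p·e = T`. Induction on `n`: `σ^{pⁿ}` fixes `E[M·pⁿ]` pointwise; in fixing-group form
`σ ∈ Γ_{K(E[M])} ⟹ σ^{pⁿ} ∈ Γ_{K(E[M pⁿ])}`, and in field form `σ^{pⁿ}` fixes `K(E[M pⁿ])` pointwise.

* `smul_pow_eq_add_nsmul` — `g` fixes `g•a − a` ⟹ `gᵏ•a = a + k•(g•a − a)` (any distributive action of a monoid on an additive group).
* `smul_pow_prime_eq_self_of_forall` — `σ` fixes the `M`-torsion pointwise, `p ∣ M`, `(M·p)•x = 0` ⟹ `σᵖ•x = x`.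
* `smul_pow_prime_pow_eq_self_of_forall` — induction: `(M·pⁿ)•x = 0 ⟹ σ^{pⁿ}•x = x`.
* `pow_prime_pow_mem_fixingSubgroupOfModule_geomTorsion` — `σ ∈ Γ_{K(E[M])} ⟹ σ^{pⁿ} ∈ Γ_{K(E[M·pⁿ])}`.
* `pow_prime_pow_smul_eq_self_of_mem_divisionField` — the field form on `W.divisionField (M * p ^ n)`.

## References
* [SilvermanAEC2009] J. H. Silverman, *The Arithmetic of Elliptic Curves*, III.§7 (the action on `E[m]`), VIII.§1.
* [Serre1972] J.-P. Serre, *Propriétés galoisiennes des points d'ordre fini des courbes elliptiques*, §4.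
-/

noncomputable section

open scoped Classical
open Field Literature.NumberTheory.EllipticCurves Literature.NumberTheory.GaloisRepresentations

universe u

namespace WeierstrassCurve

/-! ### §1. One group-action identity -/

section Action

variable {G A : Type*} [Monoid G] [AddCommGroup A] [DistribMulAction G A]

/-- **`gᵏ•a = a + k•(g•a − a)` when `g` fixes `g•a − a`** (the orbit of `a` under `⟨g⟩` is an arithmetic progression).
[cite: SilvermanAEC2009, III.§7 (the action on E[m])] -/
theorem smul_pow_eq_add_nsmul (g : G) (a : A) (h : g • (g • a - a) = g • a - a) (k : ℕ) :
    g ^ k • a = a + k • (g • a - a) := by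
  induction k with
  | zero => simp
  | succ k ih =>
    have hga : g • a = a + (g • a - a) := by abel
    rw [pow_succ', mul_smul, ih, smul_add, smul_comm g k (g • a - a), h, add_smul, one_smul, hga]
    abel

end Action

/-! ### §2. `σ` fixes `E[M]` pointwise ⟹ `σ^{pⁿ}` fixes `E[M·pⁿ]` pointwise (`p ∣ M`) -/

variable {K : Type u} [Field K] (W : WeierstrassCurve K)

/-- **`σ` fixes the `M`-torsion pointwise and `p ∣ M` ⟹ `σᵖ` fixes the `M·p`-torsion pointwise** (on geometric points): with
`e := σx − x`, `p•e = 0` (`px` is `M`-torsion, fixed) and `M•e = 0` (so `σ` fixes `e`), hence `σᵖx = x + p•e = x`.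
[cite: SilvermanAEC2009, III.§7] [cite: Serre1972, §4] -/
theorem smul_pow_prime_eq_self_of_forall {M p : ℕ} (hpM : p ∣ M) (σ : absoluteGaloisGroup K)
    (hσ : ∀ x : geomPoints W, (M : ℤ) • x = 0 → σ • x = x) (x : geomPoints W) (hx : ((M * p : ℕ) : ℤ) • x = 0) :
    σ ^ p • x = x := by
  obtain ⟨c, hc⟩ := hpM
  -- `p•x` is `M`-torsion, hence fixed by `σ`
  have hpx : (M : ℤ) • ((p : ℤ) • x) = 0 := by
    rw [smul_smul, ← hx]
    push_cast
    ring_nf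
  have hfix : σ • ((p : ℤ) • x) = (p : ℤ) • x := hσ _ hpx
  -- `e := σx − x`: `p•e = 0`, `M•e = 0`, `σ` fixes `e`
  have hpe : (p : ℤ) • (σ • x - x) = 0 := by
    rw [smul_sub, smul_comm (p : ℤ) σ x, hfix, sub_self]
  have hMe : (M : ℤ) • (σ • x - x) = 0 := by
    rw [hc, Nat.cast_mul, mul_comm, ← smul_smul, hpe, smul_zero]
  have hfe : σ • (σ • x - x) = σ • x - x := hσ _ hMe
  rw [smul_pow_eq_add_nsmul σ x hfe p, ← natCast_zsmul, hpe, add_zero]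

/-- **Induction: `σ` fixes the `M`-torsion pointwise and `p ∣ M` ⟹ `σ^{pⁿ}` fixes the `M·pⁿ`-torsion pointwise.**
[cite: SilvermanAEC2009, III.§7] [cite: Serre1972, §4] -/
theorem smul_pow_prime_pow_eq_self_of_forall {M p : ℕ} (hpM : p ∣ M) (σ : absoluteGaloisGroup K)
    (hσ : ∀ x : geomPoints W, (M : ℤ) • x = 0 → σ • x = x) (n : ℕ) :
    ∀ x : geomPoints W, ((M * p ^ n : ℕ) : ℤ) • x = 0 → σ ^ p ^ n • x = x := by
  induction n with
  | zero => simpa using hσ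
  | succ n ih =>
    intro x hx
    have h := W.smul_pow_prime_eq_self_of_forall (M := M * p ^ n) (p := p) (Dvd.dvd.mul_right hpM _) (σ ^ p ^ n) ih x
      (by rw [mul_assoc, ← pow_succ]; exact hx)
    rwa [← pow_mul, ← pow_succ] at h

/-- **`σ ∈ Γ_{K(E[M])} ⟹ σ^{pⁿ} ∈ Γ_{K(E[M·pⁿ])}`** (`p ∣ M`): every element of `Gal(K̄/K(E[M]))` has `p`-power order on `E[M·pⁿ]`.
[cite: SilvermanAEC2009, III.§7, VIII.§1] [cite: Serre1972, §4] -/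
theorem pow_prime_pow_mem_fixingSubgroupOfModule_geomTorsion {M p : ℕ} (hpM : p ∣ M) {σ : absoluteGaloisGroup K}
    (hσ : σ ∈ fixingSubgroupOfModule K (geomTorsion W M)) (n : ℕ) :
    σ ^ p ^ n ∈ fixingSubgroupOfModule K (geomTorsion W (M * p ^ n : ℕ)) := by
  rw [mem_fixingSubgroupOfModule_geomTorsion_iff] at hσ ⊢
  have hσ' : ∀ x : geomPoints W, (M : ℤ) • x = 0 → σ • x = x := fun x hx ↦
    congrArg Subtype.val (hσ ⟨x, (Submodule.mem_torsionBy_iff (M : ℤ) x).mpr hx⟩)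
  intro T
  exact Subtype.ext (W.smul_pow_prime_pow_eq_self_of_forall hpM σ hσ' n T ((Submodule.mem_torsionBy_iff _ (T : geomPoints W)).mp T.2))

/-- **Field form: `σ ∈ Γ_{K(E[M])} ⟹ σ^{pⁿ}` fixes `K(E[M·pⁿ])` pointwise** (`p ∣ M`) — the «pow-fix» clause of a tower hypothesis package
along the `p`-division tower. [cite: SilvermanAEC2009, VIII.§1] [cite: Serre1972, §4] -/
theorem pow_prime_pow_smul_eq_self_of_mem_divisionField {M p : ℕ} (hpM : p ∣ M) {σ : absoluteGaloisGroup K}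
    (hσ : σ ∈ fixingSubgroupOfModule K (geomTorsion W M)) (n : ℕ)
    (x : W.divisionField (M * p ^ n)) : (σ ^ p ^ n) • (x : AlgebraicClosure K) = x :=
  (W.mem_divisionField_iff (M * p ^ n)).mp x.2 (σ ^ p ^ n)
    ((W.mem_fixingSubgroupOfModule_geomTorsion_iff (M * p ^ n)).mp (W.pow_prime_pow_mem_fixingSubgroupOfModule_geomTorsion hpM hσ n))

end WeierstrassCurve

end
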